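import Mathlib
import Summits.Ventures.PercRepro2.Defs
import Summits.Ventures.PercRepro2.Graph
import Summits.Ventures.PercRepro2.Harris
import Summits.Ventures.PercRepro2.Events
import Summits.Ventures.PercRepro2.Independence
import Summits.Ventures.PercRepro2.Induced
import Summits.Ventures.PercRepro2.Exploration
import Summits.Ventures.PercRepro2.SideCluster

/-!
# Triangular cacti built from the root, and the cluster law along a pendant edge
(blind cell PercRepro2, mine-c g10; proofs/MINEC-FEEDBACK.md §13)

A TRIANGULAR CACTUS FROM `s` is an edge set `F ⊆ E` built from `∅` by repeatedly attaching a
PENDANT EDGE `{x, y}` (the new vertex `y` incident to no edge of `F`, `y ≠ s`) or a PENDANT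
TRIANGLE `{x, y, z}` (new vertices `y, z`) at an arbitrary vertex `x` (`IsCactusFrom`). Every
triangular cactus containing `s` arises this way (attach the block of `s` first, at `x = s`, and
grow outward; paper remark).

The cluster law of `G[F]` is `massOn F W = P(C(s) = W in restrict F ω)` — the configuration with
every edge outside `F` closed — on the SAME configuration space. Along a pendant edge it
factorises (`massOn_insert_edge`): `massOn (insert e F) W = massOn F (W.erase y) · gEdge W`, with
`gEdge` the trace law of the edge (`p`, `1 − p`, `1` or `0` according to `x ∈ W`, `y ∈ W`), which
is log-supermodular (`gEdge_lsm`). The triangle step is in `CactusTriangle.lean`, the induction in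
`CactusCluster.lean`.
-/

namespace Summit.Ventures.PercRepro2

namespace Cactus

open scoped Classical

/- Every `restrict F ω` in this file must carry the same decidability instance; the classical one
wins over `Set.decidableInsert` and friends. -/
attribute [local instance 2000] Classical.propDecidable

variable {V : Type*} {E : Type*} [Fintype E] [Fintype V]
variable {R : Type*} [Field R] [LinearOrder R] [IsStrictOrderedRing R]

/-! ## The class -/

/-- **Triangular cacti from the root `s`**: the edge sets built from `∅` by pendant edges and
pendant triangles attached at an existing vertex `x`, the new vertices never being the root. -/
inductive IsCactusFrom (ends : E → Sym2 V) (s : V) : Set E → Prop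
  | empty : IsCactusFrom ends s ∅
  | edge {F : Set E} (hF : IsCactusFrom ends s F) {e : E} {x y : V} (he : ends e = s(x, y))
      (hxy : x ≠ y) (hys : y ≠ s) (hy : ∀ e' ∈ F, y ∉ ends e') (heF : e ∉ F) :
      IsCactusFrom ends s (insert e F)
  | triangle {F : Set E} (hF : IsCactusFrom ends s F) {e₁ e₂ e₃ : E} {x y z : V}
      (h₁ : ends e₁ = s(x, y)) (h₂ : ends e₂ = s(x, z)) (h₃ : ends e₃ = s(y, z))
      (hxy : x ≠ y) (hxz : x ≠ z) (hyz : y ≠ z) (hys : y ≠ s) (hzs : z ≠ s)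
      (hy : ∀ e' ∈ F, y ∉ ends e') (hz : ∀ e' ∈ F, z ∉ ends e')
      (h₁₂ : e₁ ≠ e₂) (h₁₃ : e₁ ≠ e₃) (h₂₃ : e₂ ≠ e₃) (hn₁ : e₁ ∉ F) (hn₂ : e₂ ∉ F) (hn₃ : e₃ ∉ F) :
      IsCactusFrom ends s (insert e₁ (insert e₂ (insert e₃ F)))

/-! ## The cluster law of `G[F]` -/

omit [Fintype E] [Fintype V] in
/-- The cluster of `s` when only the edges of `F` are kept. -/
def clusterOn (ends : E → Sym2 V) (F : Set E) (ω : Config E) (s : V) : Set V :=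
  cluster ends (restrict F ω) s

omit [LinearOrder R] [IsStrictOrderedRing R] [Fintype V] in
/-- The cluster law of `G[F]`: `P(C(s) = W)` with the edges outside `F` closed. -/
noncomputable def massOn (p : E → R) (ends : E → Sym2 V) (F : Set E) (s : V) (W : Finset V) : R :=
  prob p {ω | clusterOn ends F ω s = ↑W}

omit [Fintype E] [Fintype V] in
/-- An open edge of `restrict F ω` is an open edge of `ω` lying in `F`. -/
lemma openAdj_restrict_iff {ends : E → Sym2 V} {F : Set E} {ω : Config E} {a b : V} :
    OpenAdj ends (restrict F ω) a b ↔ ∃ e, ω e = true ∧ e ∈ F ∧ ends e = s(a, b) := by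
  constructor
  · rintro ⟨e, he, hends⟩
    exact ⟨e, (restrict_eq_true_iff.1 he).1, (restrict_eq_true_iff.1 he).2, hends⟩
  · rintro ⟨e, he, heF, hends⟩
    exact ⟨e, restrict_eq_true_iff.2 ⟨he, heF⟩, hends⟩

omit [Fintype E] [Fintype V] in
/-- `restrict F ω ≤ restrict F' ω` for `F ⊆ F'`. -/
lemma restrict_mono_set {F F' : Set E} (h : F ⊆ F') (ω : Config E) :
    restrict F ω ≤ restrict F' ω := by
  intro e
  by_cases he : e ∈ F
  · rw [restrict_apply_of_mem he, restrict_apply_of_mem (h he)]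
  · rw [restrict_apply_of_notMem he]; exact Bool.false_le _

omit [Fintype E] [Fintype V] in
/-- A vertex incident to no edge of `F` is isolated in `G[F]`. -/
lemma eq_of_conn_restrict_of_isolated {ends : E → Sym2 V} {F : Set E} {ω : Config E} {y v : V}
    (hy : ∀ e' ∈ F, y ∉ ends e') (h : Conn ends (restrict F ω) v y) : v = y := by
  obtain ⟨q⟩ := h
  cases hq : q.reverse with
  | nil => rfl
  | cons hadj r =>
    rw [openGraph_adj] at hadj
    obtain ⟨_, hadj⟩ := hadj
    obtain ⟨e, _, heF, hends⟩ := openAdj_restrict_iff.1 hadj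
    exact (hy e heF (by rw [hends]; exact Sym2.mem_mk_left _ _)).elim

/-! ## The pendant edge -/

section Edge

variable {ends : E → Sym2 V} {F : Set E} {e : E} {x y s : V}

omit [Fintype E] [Fintype V] in
/-- **The cluster of `G[F ∪ {e}]`** for a pendant edge `e = {x, y}` (`y` new, `y ≠ s`): the cluster
of `G[F]`, together with `y` iff `x` is in it and `e` is open. -/
lemma clusterOn_insert_edge (he : ends e = s(x, y)) (hxy : x ≠ y) (hys : y ≠ s)
    (hy : ∀ e' ∈ F, y ∉ ends e') (ω : Config E) (v : V) :
    v ∈ clusterOn ends (insert e F) ω s ↔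
      v ∈ clusterOn ends F ω s ∨ (v = y ∧ x ∈ clusterOn ends F ω s ∧ ω e = true) := by
  simp only [clusterOn, mem_cluster]
  constructor
  · intro h
    let S : Set V := {v | Conn ends (restrict F ω) s v ∨
      (v = y ∧ Conn ends (restrict F ω) s x ∧ ω e = true)}
    have hS : ∀ v ∈ S, ∀ v', (openGraph ends (restrict (insert e F) ω)).Adj v v' → v' ∈ S := by
      intro v hv v' hadj
      obtain ⟨_, hadj⟩ := openGraph_adj.1 hadj
      obtain ⟨e', he', he'F, hends⟩ := openAdj_restrict_iff.1 hadj
      rcases hv with hv | ⟨rfl, hx, hopen⟩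
      · rcases Set.mem_insert_iff.1 he'F with rfl | he'F
        · -- the pendant edge itself: `v = x` (since `v ≠ y`), `v' = y`
          rw [he, Sym2.eq_iff] at hends
          rcases hends with ⟨rfl, rfl⟩ | ⟨rfl, rfl⟩
          · exact Or.inr ⟨rfl, hv, he'⟩
          · -- `v = y` has no edge of `F`: `s ↔ y` in `G[F]` forces `y = s`
            exact (hys (eq_of_conn_restrict_of_isolated hy hv).symm).elim
        · exact Or.inl (conn_trans hv (conn_of_openAdj (openAdj_restrict_iff.2 ⟨e', he', he'F, hends⟩)))
      · -- from `y`: the only edge at `y` is `e`, back to `x`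
        rcases Set.mem_insert_iff.1 he'F with rfl | he'F
        · rw [he, Sym2.eq_iff] at hends
          rcases hends with ⟨h1, _⟩ | ⟨h1, _⟩
          · exact (hxy h1).elim
          · rw [← h1]; exact Or.inl hx
        · exact (hy e' he'F (by rw [hends]; exact Sym2.mem_mk_left _ _)).elim
    have hvS : v ∈ S := mem_of_conn_of_closed hS (Or.inl (conn_refl _ _ _)) h
    exact hvS
  · rintro (h | ⟨rfl, hx, hopen⟩)
    · exact h.mono (openGraph_mono (restrict_mono_set (Set.subset_insert e F) ω))
    · refine conn_trans (hx.mono (openGraph_mono (restrict_mono_set (Set.subset_insert e F) ω))) ?_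
      exact conn_of_openAdj (openAdj_restrict_iff.2 ⟨e, hopen, Set.mem_insert e F, he⟩)

omit [Fintype E] [Fintype V] in
/-- `y` never lies in the cluster of `G[F]`. -/
lemma y_notMem_clusterOn (hys : y ≠ s) (hy : ∀ e' ∈ F, y ∉ ends e') (ω : Config E) :
    y ∉ clusterOn ends F ω s := fun h => hys (eq_of_conn_restrict_of_isolated hy h).symm

omit [Fintype E] [Fintype V] [LinearOrder R] [IsStrictOrderedRing R] in
/-- The trace law of a pendant edge on the two bits `x ∈ W`, `y ∈ W`. -/
noncomputable def gBool (q : R) (a b : Bool) : R :=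
  if a then (if b then q else 1 - q) else (if b then 0 else 1)

omit [Fintype E] [Fintype V] [LinearOrder R] [IsStrictOrderedRing R] in
/-- The trace law of a pendant edge. -/
noncomputable def gEdge (p : E → R) (e : E) (x y : V) (W : Finset V) : R :=
  gBool (p e) (decide (x ∈ W)) (decide (y ∈ W))

omit [Fintype E] [Fintype V] [LinearOrder R] [IsStrictOrderedRing R] in
/-- `x, y ∈ W`: the edge is open. -/
lemma gEdge_of_mem_mem (p : E → R) (e : E) {x y : V} {W : Finset V} (hx : x ∈ W) (hy : y ∈ W) :
    gEdge p e x y W = p e := by simp [gEdge, gBool, hx, hy]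

omit [Fintype E] [Fintype V] [LinearOrder R] [IsStrictOrderedRing R] in
/-- `x ∈ W`, `y ∉ W`: the edge is closed. -/
lemma gEdge_of_mem_notMem (p : E → R) (e : E) {x y : V} {W : Finset V} (hx : x ∈ W)
    (hy : y ∉ W) : gEdge p e x y W = 1 - p e := by simp [gEdge, gBool, hx, hy]

omit [Fintype E] [Fintype V] [LinearOrder R] [IsStrictOrderedRing R] in
/-- `x ∉ W`, `y ∈ W`: impossible. -/
lemma gEdge_of_notMem_mem (p : E → R) (e : E) {x y : V} {W : Finset V} (hx : x ∉ W)
    (hy : y ∈ W) : gEdge p e x y W = 0 := by simp [gEdge, gBool, hx, hy]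

omit [Fintype E] [Fintype V] [LinearOrder R] [IsStrictOrderedRing R] in
/-- `x, y ∉ W`: the edge is free. -/
lemma gEdge_of_notMem_notMem (p : E → R) (e : E) {x y : V} {W : Finset V} (hx : x ∉ W)
    (hy : y ∉ W) : gEdge p e x y W = 1 := by simp [gEdge, gBool, hx, hy]

omit [LinearOrder R] [IsStrictOrderedRing R] [Fintype V] in
/-- **The cluster law along a pendant edge**: `massOn (insert e F) W = massOn F (W.erase y) · gEdge W`. -/
theorem massOn_insert_edge (p : E → R) (he : ends e = s(x, y)) (hxy : x ≠ y) (hys : y ≠ s)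
    (hy : ∀ e' ∈ F, y ∉ ends e') (heF : e ∉ F) (W : Finset V) :
    massOn p ends (insert e F) s W = massOn p ends F s (W.erase y) * gEdge p e x y W := by
  unfold massOn
  -- the event of `G[F ∪ {e}]` as an event of `G[F]` intersected with the status of `e`
  have hdep : DependsOn (· ∈ {ω : Config E | clusterOn ends F ω s = ↑(W.erase y)}) F :=
    dependsOn_restrict F (fun ω' => cluster ends ω' s = ↑(W.erase y))
  have hdisj : Disjoint F ({e} : Set E) := Set.disjoint_singleton_right.2 heF
  by_cases hx : x ∈ W
  · by_cases hyW : y ∈ W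
    · rw [gEdge_of_mem_mem p e hx hyW]
      have hset : {ω : Config E | clusterOn ends (insert e F) ω s = ↑W} =
          {ω | clusterOn ends F ω s = ↑(W.erase y)} ∩ openEdge e := by
        ext ω
        simp only [Set.mem_setOf_eq, Set.mem_inter_iff, openEdge]
        constructor
        · intro h
          have hyC : y ∈ clusterOn ends (insert e F) ω s := by rw [h]; exact Finset.mem_coe.2 hyW
          obtain ⟨_, hxC, hopen⟩ := ((clusterOn_insert_edge he hxy hys hy ω y).1 hyC).resolve_left
            (y_notMem_clusterOn hys hy ω)
          refine ⟨?_, hopen⟩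
          ext v
          simp only [Finset.coe_erase, Set.mem_sdiff, Set.mem_singleton_iff]
          constructor
          · intro hv
            refine ⟨?_, fun hvy => y_notMem_clusterOn hys hy ω (hvy ▸ hv)⟩
            have : v ∈ clusterOn ends (insert e F) ω s :=
              (clusterOn_insert_edge he hxy hys hy ω v).2 (Or.inl hv)
            rw [h] at this; exact this
          · rintro ⟨hv, hvy⟩
            have : v ∈ clusterOn ends (insert e F) ω s := by rw [h]; exact hv
            rcases (clusterOn_insert_edge he hxy hys hy ω v).1 this with h' | ⟨rfl, _⟩
            · exact h'
            · exact (hvy rfl).elim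
        · rintro ⟨h, hopen⟩
          have hxC : x ∈ clusterOn ends F ω s := by
            rw [h]; simp only [Finset.coe_erase, Set.mem_sdiff, Set.mem_singleton_iff]
            exact ⟨Finset.mem_coe.2 hx, hxy⟩
          ext v
          rw [clusterOn_insert_edge he hxy hys hy ω v, h]
          simp only [Finset.coe_erase, Set.mem_sdiff, Set.mem_singleton_iff, Finset.mem_coe]
          constructor
          · rintro (⟨hv, _⟩ | ⟨rfl, _, _⟩)
            · exact hv
            · exact hyW
          · intro hv
            by_cases hvy : v = y
            · exact Or.inr ⟨hvy, ⟨hx, hxy⟩, hopen⟩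
            · exact Or.inl ⟨hv, hvy⟩
      rw [hset, prob_inter_eq_mul_of_dependsOn p hdisj hdep (dependsOn_openEdge e), prob_openEdge]
    · rw [gEdge_of_mem_notMem p e hx hyW]
      have hset : {ω : Config E | clusterOn ends (insert e F) ω s = ↑W} =
          {ω | clusterOn ends F ω s = ↑(W.erase y)} ∩ closedEdge e := by
        ext ω
        simp only [Set.mem_setOf_eq, Set.mem_inter_iff, closedEdge]
        rw [Finset.erase_eq_of_notMem hyW]
        constructor
        · intro h
          have hxC : x ∈ clusterOn ends (insert e F) ω s := by rw [h]; exact Finset.mem_coe.2 hx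
          have hxF : x ∈ clusterOn ends F ω s := by
            rcases (clusterOn_insert_edge he hxy hys hy ω x).1 hxC with h' | ⟨h', _⟩
            · exact h'
            · exact (hxy h').elim
          refine ⟨?_, ?_⟩
          · ext v
            constructor
            · intro hv
              have : v ∈ clusterOn ends (insert e F) ω s :=
                (clusterOn_insert_edge he hxy hys hy ω v).2 (Or.inl hv)
              rw [h] at this; exact this
            · intro hv
              have : v ∈ clusterOn ends (insert e F) ω s := by rw [h]; exact hv
              rcases (clusterOn_insert_edge he hxy hys hy ω v).1 this with h' | ⟨rfl, _⟩
              · exact h'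
              · exact (hyW (Finset.mem_coe.1 hv)).elim
          · by_contra hopen
            have hyC : y ∈ clusterOn ends (insert e F) ω s :=
              (clusterOn_insert_edge he hxy hys hy ω y).2
                (Or.inr ⟨rfl, hxF, by simpa using hopen⟩)
            rw [h] at hyC
            exact hyW (Finset.mem_coe.1 hyC)
        · rintro ⟨h, hclosed⟩
          ext v
          rw [clusterOn_insert_edge he hxy hys hy ω v, h]
          constructor
          · rintro (hv | ⟨_, _, hopen⟩)
            · exact hv
            · rw [hclosed] at hopen; exact absurd hopen Bool.false_ne_true
          · exact fun hv => Or.inl hv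
      rw [hset, prob_inter_eq_mul_of_dependsOn p hdisj hdep (dependsOn_closedEdge e),
        prob_closedEdge]
  · by_cases hyW : y ∈ W
    · -- `y ∈ W` without `x ∈ W` is impossible
      rw [gEdge_of_notMem_mem p e hx hyW, mul_zero]
      rw [show {ω : Config E | clusterOn ends (insert e F) ω s = ↑W} = ∅ from ?_, prob_empty]
      rw [Set.eq_empty_iff_forall_notMem]
      intro ω h
      have hyC : y ∈ clusterOn ends (insert e F) ω s := by
        show y ∈ clusterOn ends (insert e F) ω s
        rw [Set.mem_setOf_eq.mp h]; exact Finset.mem_coe.2 hyW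
      obtain ⟨_, hxC, _⟩ := ((clusterOn_insert_edge he hxy hys hy ω y).1 hyC).resolve_left
        (y_notMem_clusterOn hys hy ω)
      have : x ∈ clusterOn ends (insert e F) ω s :=
        (clusterOn_insert_edge he hxy hys hy ω x).2 (Or.inl hxC)
      rw [Set.mem_setOf_eq.mp h] at this
      exact hx (Finset.mem_coe.1 this)
    · rw [gEdge_of_notMem_notMem p e hx hyW, mul_one, Finset.erase_eq_of_notMem hyW]
      congr 1
      ext ω
      simp only [Set.mem_setOf_eq]
      constructor
      · intro h
        ext v
        constructor
        · intro hv
          have : v ∈ clusterOn ends (insert e F) ω s :=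
            (clusterOn_insert_edge he hxy hys hy ω v).2 (Or.inl hv)
          rw [h] at this; exact this
        · intro hv
          have : v ∈ clusterOn ends (insert e F) ω s := by rw [h]; exact hv
          rcases (clusterOn_insert_edge he hxy hys hy ω v).1 this with h' | ⟨rfl, _⟩
          · exact h'
          · exact (hyW (Finset.mem_coe.1 hv)).elim
      · intro h
        ext v
        rw [clusterOn_insert_edge he hxy hys hy ω v, h]
        constructor
        · rintro (hv | ⟨_, hxC, _⟩)
          · exact hv
          · exact (hx (Finset.mem_coe.1 hxC)).elim
        · exact fun hv => Or.inl hv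

omit [Fintype E] [Fintype V] in
/-- The trace law of a pendant edge is log-supermodular in its two bits. -/
lemma gBool_lsm {q : R} (h0 : 0 ≤ q) (P₁ Q₁ P₂ Q₂ : Prop) :
    gBool q (decide P₁) (decide Q₁) * gBool q (decide P₂) (decide Q₂) ≤
      gBool q (decide (P₁ ∧ P₂)) (decide (Q₁ ∧ Q₂)) *
        gBool q (decide (P₁ ∨ P₂)) (decide (Q₁ ∨ Q₂)) := by
  by_cases hP₁ : P₁ <;> by_cases hQ₁ : Q₁ <;> by_cases hP₂ : P₂ <;> by_cases hQ₂ : Q₂ <;>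
    simp [*, gBool]
  -- the one incomparable pair `({x}, {x, y})` against `({x}, {x})`... the remaining case
  nlinarith

omit [Fintype E] [Fintype V] in
/-- **The trace law of a pendant edge is log-supermodular.** -/
theorem gEdge_lsm {p : E → R} (hp : IsProbVec p) (e : E) (x y : V) (W₁ W₂ : Finset V) :
    gEdge p e x y W₁ * gEdge p e x y W₂ ≤ gEdge p e x y (W₁ ∩ W₂) * gEdge p e x y (W₁ ∪ W₂) := by
  unfold gEdge
  simp only [Finset.mem_inter, Finset.mem_union]
  exact gBool_lsm (hp.nonneg e) _ _ _ _

end Edge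

end Cactus

end Summit.Ventures.PercRepro2
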